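import Literature.Probability.LatticeModels.RandomClusterRimWiring
import Literature.Probability.LatticeModels.RandomClusterSuccessiveConditioning
import HarnessLib

/-!
# Domain Markov with the rim wired from outside: summed over an outside event (proved)

Topic `Literature/Probability/LatticeModels` (trunk `StatMech`, family `crit-ising`). Companion of
`RandomClusterRimWiring.lean`, whose exact conditional law
`φ^∅_G({ω ∩ U ∈ A} ∩ {ω ∖ U = ζ₀}) = φ^∅_G({ω ∖ U = ζ₀}) · φ^W_{⟨U⟩}(A)` (rim `W` wired by `ζ₀`) is
summed here over an OUTSIDE EVENT `F`: if `F` is determined by the configuration off the region `U`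
and EVERY configuration `ζ ⊆ E(G) ∖ U` in `F` wires the rim (touches the vertex set `X` of the region
only at `W` and joins any two rim vertices), then for every inside event `A`,

  `φ^∅_{G,p,q}({ω ∩ U ∈ A} ∩ F) = φ^∅_{G,p,q}(F) · φ^W_{⟨U⟩,p,q}(A)`

(`rcMeasure_real_inter_eq_mul_of_rim_wired`; decomposition along the cylinders of `U`,
`rcMeasure_real_inter_eq_sum_cylinder`). This is the form in which Kesten's decomposition at the
outermost open circuit is used (H. Kesten, PTRF 73 (1986), proof of Thm. 3): with
`F = {Γ = γ} ∩ {γ ↔ ∂B(n) outside γ}` — an event determined outside `γ`, all of whose configurations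
contain the open circuit `γ` and hence wire `W = V(γ)` —, `P{0 ↔ ∂B(n), Γ = γ} = P(F) · P^{γ wired}
_{int γ}(0 ↔ γ)`. Everything is proved; no definitions.

## References

* H. Kesten, The incipient infinite cluster in two-dimensional percolation, *Probab. Theory Related
  Fields* 73 (1986), proof of Thm. 3.
* G. Grimmett, *The Random-Cluster Model* (2006), Lemma (4.13).
-/

noncomputable section

open MeasureTheory Finset SimpleGraph

namespace Literature.Probability.LatticeModels

variable {V : Type*} [Fintype V] [DecidableEq V] (G : SimpleGraph V) [DecidableRel G.Adj]

/-- **Domain Markov with the rim wired from outside, summed over an outside event** (Kesten 1986,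
proof of Thm. 3; Grimmett 2006, Lemma (4.13)). Let `U ⊆ E(G)` be a region whose edges have both
endpoints in `X`, `F` an event determined by the configuration off `U` such that every configuration
`ζ ⊆ E(G) ∖ U` with `↑ζ ∈ F` touches `X` only at rim vertices and joins any two vertices of the rim `W`
by a `ζ`-open path. Then for every event `A`,
`φ^∅_G({ω ∩ U ∈ A} ∩ F) = φ^∅_G(F) · φ^W_{⟨U⟩}(A)` (`0 ≤ p ≤ 1`, `q > 0`). [cite: Kesten1986, proof of Thm. 3] -/
theorem rcMeasure_real_inter_eq_mul_of_rim_wired {p q : ℝ}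
    (hp : p ∈ Set.Icc (0 : ℝ) 1) (hq : 0 < q) {W X : Set V} (U : Finset (Sym2 V))
    (hU : U ⊆ G.edgeFinset) (hUX : ∀ e ∈ U, ∀ x ∈ e, x ∈ X)
    (F : Set (Percolation.BondConfig V))
    (hF : ∀ ω₁ ω₂ : Percolation.BondConfig V, ω₁ ∩ (↑U)ᶜ = ω₂ ∩ (↑U)ᶜ → (ω₁ ∈ F ↔ ω₂ ∈ F))
    (hFX : ∀ ζ : Finset (Sym2 V), ζ ⊆ G.edgeFinset \ U → (↑ζ : Percolation.BondConfig V) ∈ F →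
      ∀ e ∈ ζ, ∀ x ∈ e, x ∈ X → x ∈ W)
    (hFW : ∀ ζ : Finset (Sym2 V), ζ ⊆ G.edgeFinset \ U → (↑ζ : Percolation.BondConfig V) ∈ F →
      ∀ x ∈ W, ∀ y ∈ W, (fromEdgeSet (ζ : Set (Sym2 V))).Reachable x y)
    (A : Set (Percolation.BondConfig V)) :
    (rcMeasure G p q ∅).real ({ω | ω ∩ ↑U ∈ A} ∩ F) =
      (rcMeasure G p q ∅).real F * (rcMeasure (fromEdgeSet (U : Set (Sym2 V))) p q W).real A := by
  classical
  -- decompose both sides along the cylinders of `U`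
  have hF' : (rcMeasure G p q ∅).real F = (rcMeasure G p q ∅).real (Set.univ ∩ F) := by
    rw [Set.univ_inter]
  rw [rcMeasure_real_inter_eq_sum_cylinder G hp hq ∅ U {ω | ω ∩ ↑U ∈ A} F hF, hF',
    rcMeasure_real_inter_eq_sum_cylinder G hp hq ∅ U Set.univ F hF, Finset.sum_mul]
  refine Finset.sum_congr rfl fun ζ hζ ↦ ?_
  rw [Finset.mem_filter, Finset.mem_powerset] at hζ
  rw [Set.univ_inter]
  exact rcMeasure_real_inter_cylinder_eq_mul_fromEdgeSet_rim G hp hq U hU hζ.1 hUX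
    (hFX ζ hζ.1 hζ.2) (hFW ζ hζ.1 hζ.2) A

/-- **Conditional form**: under the same hypotheses, if `φ(F) > 0` then
`φ^∅_G(ω ∩ U ∈ A | F) = φ^W_{⟨U⟩}(A)`, written as a quotient. [cite: Kesten1986, proof of Thm. 3] -/
theorem rcMeasure_real_inter_div_eq_of_rim_wired {p q : ℝ}
    (hp : p ∈ Set.Icc (0 : ℝ) 1) (hq : 0 < q) {W X : Set V} (U : Finset (Sym2 V))
    (hU : U ⊆ G.edgeFinset) (hUX : ∀ e ∈ U, ∀ x ∈ e, x ∈ X)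
    (F : Set (Percolation.BondConfig V))
    (hF : ∀ ω₁ ω₂ : Percolation.BondConfig V, ω₁ ∩ (↑U)ᶜ = ω₂ ∩ (↑U)ᶜ → (ω₁ ∈ F ↔ ω₂ ∈ F))
    (hFX : ∀ ζ : Finset (Sym2 V), ζ ⊆ G.edgeFinset \ U → (↑ζ : Percolation.BondConfig V) ∈ F →
      ∀ e ∈ ζ, ∀ x ∈ e, x ∈ X → x ∈ W)
    (hFW : ∀ ζ : Finset (Sym2 V), ζ ⊆ G.edgeFinset \ U → (↑ζ : Percolation.BondConfig V) ∈ F →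
      ∀ x ∈ W, ∀ y ∈ W, (fromEdgeSet (ζ : Set (Sym2 V))).Reachable x y)
    (hF0 : 0 < (rcMeasure G p q ∅).real F) (A : Set (Percolation.BondConfig V)) :
    (rcMeasure G p q ∅).real ({ω | ω ∩ ↑U ∈ A} ∩ F) / (rcMeasure G p q ∅).real F =
      (rcMeasure (fromEdgeSet (U : Set (Sym2 V))) p q W).real A := by
  rw [rcMeasure_real_inter_eq_mul_of_rim_wired G hp hq U hU hUX F hF hFX hFW A, mul_comm,
    mul_div_assoc, div_self hF0.ne', mul_one]

end Literature.Probability.LatticeModels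

end
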